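import Mathlib.NumberTheory.NumberField.InfinitePlace.Ramification
import Mathlib.NumberTheory.NumberField.ClassNumber
import Literature.NumberTheory.NumberFields.DecompositionGroupsPrescribed
import Literature.NumberTheory.NumberFields.ArithmeticEquivalenceSolitaryProofs
import HarnessLib

/-!
# Rigidity of equivariant place transports of a Galois number field

Topic `NumberTheory/NumberFields`. PROOF-ONLY file (no definition, no named fact, no new `Prop`; axioms
standard): classical algebraic number theory, written for the abc-iut cell's line on the compatibility clause
of [FrdI] Thm. 6.4 (iv) in the non-Galois case (GAP-LEDGER G-L1t3-1 #2; programme of seat abc-iut-L1-d3,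
steps (R2)–(R6); seat abc-iut-w5-d222). Mochizuki, *The geometry of Frobenioids I*, Kyushu J. Math. **62**
(2008), Thm. 6.4 (iv) p. 115 l. 23–29: «… is isomorphic to `L₁` in a fashion that is compatible with an
isomorphism `F₁ ⥲ F₂`» — the compatibility is asserted in print and not argued there (the printed proof,
p. 116 l. 17–35, stops at `L₁ = L₂`); nothing of [FrdI] is asserted in this file, which supplies the
number-theoretic core of OUR argument [cite: MochizukiFrdI2008, Thm. 6.4 (iv) p.115].

SETTING. `L/ℚ` finite Galois, `G = Gal(L/ℚ)` acting on the finite places `HeightOneSpectrum (𝓞 L)` (the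
tree's `Literature.NumberTheory.Automorphic.instMulActionHeightOneSpectrum`) and on the infinite places
(Mathlib). A PLACE TRANSPORT along `θ : G → G` over `H ≤ G`: a permutation `π_f` of the finite places with
`𝔭_{π_f w} ∩ ℤ = 𝔭_w ∩ ℤ`, a self-map `π_∞` of the infinite places, such that (a) every `x ∈ L^×` has a `y ∈ L^×`
with `v_{π_f w}(y) = v_w(x)` (finite `w`) and `|y|_{π_∞ v} = |x|_v` (infinite `v`), and (b)
`π_f (h • w) = θ(h) • π_f w`, `π_∞ (h • v) = θ(h) • π_∞ v` for `h ∈ H` — what an equivalence of arithmetic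
Frobenioids with its [FrdI] Cor. 4.11 (iv) datum induces at `Spec L₁`, `L₁` Galois over `ℚ`, after the
identification `L₁ ≅ L₂` (`Thm64iv_arith_fieldIso`); there `H = Gal(L/F₁)`, `θ(H) = Gal(L/F₂)`.

RESULTS (unconditional): `mul_isConj_eq_of_apply_eq` (the **`ℚ`-trick**: for `c ∈ G` inducing complex
conjugation at `w` — `exists_isConj_embedding` — `|z₁|_w = |z₂|_w` is the identity `z₁·c z₁ = z₂·c z₂` in `L`);
`eq_or_eq_inv_smul_of_apply_eq` (**`c`-orbit rigidity**: `𝔓ⁿ = (x)`, `y` supported on the prime `𝔔`,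
`|y|_w = |x|_w` ⇒ `𝔔 ∈ {𝔓, c⁻¹𝔓}`); `infinitePlace_eq_of_apply_eq` (**archimedean rigidity**: if `𝔔 = 𝔓` has
trivial decomposition group, `|y|_w = |x|_{w'}` ⇒ `w' = w`); the **main theorem**
`exists_forall_smul_eq_and_mem_conj_of_placeTransport` (`π_∞ = s • (·)` for ONE `s ∈ G` and
`θ(H) ⊆ s H s⁻¹`); `exists_eq_map_conj_of_placeTransport` (`θ(H) = H₂` of the same order ⇒ `H₂ = sHs⁻¹`);
`nonempty_algEquiv_of_placeTransport` (field form: `K₁ ≃ₐ[ℚ] K₂` for embedded fields of equal degree).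

PROOF (ours). At a prime `𝔓₀` with trivial decomposition group (Chebotarev: the tree's
`exists_place_stabilizer_eq_bot`) and `𝔓₀ⁿ = (x)` (class group), the transported `y` is supported on
`π_f 𝔓₀ = s₀ 𝔓₀`, and `|y|_{π_∞ v} = |s₀ x|_{s₀ v}` gives `π_∞ v = s₀ • v` by archimedean rigidity; so
`k_h := s₀⁻¹ θ(h)⁻¹ s₀ h` fixes every infinite place. If the pointwise stabiliser `Z` of the infinite places
is trivial, `θ(h) = s₀ h s₀⁻¹`; else `Z = {1, c}`, `c` central and the conjugation of EVERY infinite place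
(`L` CM): `c`-orbit rigidity gives `s₀⁻¹ π_f 𝔓 ∈ {𝔓, c𝔓}` at every prime, and at a prime with decomposition
group exactly `⟨h⟩` (the tree's `mem_zpowers_of_twisted_equivariant_place`, seat abc-iut-w4-d093) `k_h = c`
forces `c ∈ H`, so `θ(h) ∈ s₀ H s₀⁻¹` again. (For `L = ℚ(i)` the slack is real: swapping the two primes above
any set of split `p` is a place transport along `θ = id` — only conjugacy of `H` AS A SET can be concluded.)
CONSUMER RECIPE: `π_f` from a bijection of `FinitePlace L` via Mathlib's `FinitePlace.maximalIdeal`/`.mk`;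
`hover` from residue characteristics via the tree's `liesOver_residueChar`; the valuation clause from
`ordFin`-compatibility of principal divisors; the archimedean clause from the monomial decomposition of `Ψ^Φ`
(trivial scalings: all infinite places of a Galois `L` have one type); equivariance from naturality of `Ψ^Φ`.

References: J. Neukirch, *Algebraic Number Theory*, Springer 1999, Ch. I §9, Ch. VII §13 (decomposition
groups, Chebotarev) [NeukirchANT1999]; S. Mochizuki, *The geometry of Frobenioids I*, Kyushu J. Math. 62
(2008), Thm. 6.4 (iv) p. 115 (locus served; nothing of it asserted) [MochizukiFrdI2008]. Honest framing:
nothing here bears on, or takes a side on, [IUTchIII] Cor. 3.12, and nothing asserts anything about abc.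
-/

noncomputable section

open NumberField IsDedekindDomain Literature.NumberTheory.Automorphic
open scoped Pointwise nonZeroDivisors

namespace Literature.NumberTheory.NumberFields

section Helpers

variable {L : Type} [Field L] [NumberField L]

/-- For `L` Galois over `ℚ`, complex conjugation at any infinite place `w` is induced by an element of
`Gal(L/ℚ)`: some `c` with `conj ∘ φ_w = φ_w ∘ c` (`c = 1` when `w` is real). [folklore] -/
private theorem exists_isConj_embedding [IsGalois ℚ L] (w : InfinitePlace L) :
    ∃ c : L ≃ₐ[ℚ] L, ComplexEmbedding.IsConj w.embedding c := by
  obtain ⟨σ, hσ⟩ := NumberField.ComplexEmbedding.exists_comp_symm_eq_of_comp_eq (k := ℚ) w.embedding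
    (ComplexEmbedding.conjugate w.embedding) (Subsingleton.elim _ _)
  exact ⟨σ.symm, hσ.symm⟩

/-- The conjugation `c` of an infinite place `w` fixes `w`. [folklore] -/
private theorem smul_eq_of_isConj_embedding {w : InfinitePlace L} {c : L ≃ₐ[ℚ] L}
    (hc : ComplexEmbedding.IsConj w.embedding c) : c • w = w := by
  have h := (InfinitePlace.mem_stabilizer_mk_iff (k := ℚ) w.embedding c).mpr (Or.inr hc)
  rwa [InfinitePlace.mk_embedding, MulAction.mem_stabilizer_iff] at h

/-- **The `ℚ`-trick.** If `c ∈ Gal(L/ℚ)` induces complex conjugation at the infinite place `w`, then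
`|z|_w` determines `z · c(z)`: `φ_w(z · c z) = |z|_w²`; hence `|z₁|_w = |z₂|_w` forces the identity
`z₁ · c z₁ = z₂ · c z₂` of ELEMENTS of `L`. [folklore] -/
private theorem mul_isConj_eq_of_apply_eq {w : InfinitePlace L} {c : L ≃ₐ[ℚ] L}
    (hc : ComplexEmbedding.IsConj w.embedding c) {z₁ z₂ : L} (h : w z₁ = w z₂) :
    z₁ * c z₁ = z₂ * c z₂ := by
  have key : ∀ z : L, w.embedding (z * c z) = (((w z) ^ 2 : ℝ) : ℂ) := fun z => by
    rw [map_mul, hc.eq, Complex.star_def, Complex.mul_conj, Complex.normSq_eq_norm_sq,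
      InfinitePlace.norm_embedding_eq, Complex.ofReal_pow]
  apply w.embedding.injective
  rw [key, key, h]

/-- `Gal(L/ℚ)` is transitive on the infinite places of a Galois number field `L`. [folklore] -/
private theorem exists_smul_infinitePlace_eq [IsGalois ℚ L] (w w' : InfinitePlace L) :
    ∃ t : L ≃ₐ[ℚ] L, t • w = w' :=
  InfinitePlace.exists_smul_eq_of_comap_eq (Subsingleton.elim _ _)

/-- Some power of every nonzero prime of `𝓞 L` is principal (finiteness of the class group).
[folklore] -/
private theorem exists_pow_asIdeal_eq_span (𝔓 : HeightOneSpectrum (𝓞 L)) :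
    ∃ (n : ℕ) (x : 𝓞 L), n ≠ 0 ∧ 𝔓.asIdeal ^ n = Ideal.span {x} := by
  classical
  have hImem : 𝔓.asIdeal ∈ (Ideal (𝓞 L))⁰ := mem_nonZeroDivisors_of_ne_zero 𝔓.ne_bot
  have hprinc : (𝔓.asIdeal ^ classNumber L).IsPrincipal := by
    have h1 : ClassGroup.mk0 ⟨𝔓.asIdeal, hImem⟩ ^ classNumber L = 1 := by
      rw [classNumber]; exact pow_card_eq_one
    rw [← map_pow, ClassGroup.mk0_eq_one_iff] at h1
    simpa only [SubmonoidClass.coe_pow] using h1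
  haveI := hprinc
  exact ⟨classNumber L, Submodule.IsPrincipal.generator (𝔓.asIdeal ^ classNumber L),
    (classNumber_pos L).ne', (Ideal.span_singleton_generator _).symm⟩

/-- If `𝔓ⁿ = (x)` with `n ≠ 0`, then `x` lies in the prime `𝔭_w` iff `w = 𝔓`. [folklore] -/
private theorem mem_asIdeal_iff_eq_of_pow_eq_span {𝔓 : HeightOneSpectrum (𝓞 L)} {n : ℕ} (hn : n ≠ 0)
    {x : 𝓞 L} (hx : 𝔓.asIdeal ^ n = Ideal.span {x}) (w : HeightOneSpectrum (𝓞 L)) :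
    x ∈ w.asIdeal ↔ w = 𝔓 := by
  rw [← Ideal.span_singleton_le_iff_mem, ← hx, Ideal.IsPrime.pow_le_iff hn]
  constructor
  · intro h
    exact (HeightOneSpectrum.ext
      ((Ideal.IsPrime.isMaximal 𝔓.isPrime 𝔓.ne_bot).eq_of_le w.isPrime.ne_top h)).symm
  · rintro rfl
    exact le_rfl

/-- Galois translates of a principal prime power: `(g • 𝔓)ⁿ = (g • x)`. [folklore] -/
private theorem smul_pow_asIdeal_eq_span (g : L ≃ₐ[ℚ] L) {𝔓 : HeightOneSpectrum (𝓞 L)} {n : ℕ} {x : 𝓞 L}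
    (hx : 𝔓.asIdeal ^ n = Ideal.span {x}) : (g • 𝔓).asIdeal ^ n = Ideal.span {g • x} := by
  rw [HeightOneSpectrum.smul_asIdeal, ← smul_pow', hx, Ideal.smul_closure, Set.smul_set_singleton]

/-! ### The two ideal-theoretic consequences of the `ℚ`-trick -/

/-- **`c`-orbit rigidity.** Let `𝔓ⁿ = (x)` (`n ≠ 0`) and let `y ∈ 𝓞 L` lie in no prime other than `𝔔`.
If `|y|_w = |x|_w` at an infinite place `w` whose complex conjugation is induced by `c ∈ Gal(L/ℚ)`, then
`𝔔 = 𝔓` or `𝔔 = c⁻¹ • 𝔓` (the `ℚ`-trick gives `y · c y = x · c x`, so `(y)(c y) = 𝔓ⁿ (c 𝔓)ⁿ ⊆ 𝔓`, and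
`𝔓` is prime). Step of OUR proof of the [FrdI] Thm. 6.4 (iv) compatibility clause (CM branch); not a
statement of the source. [cite: MochizukiFrdI2008, Thm. 6.4 (iv) p.115] -/
theorem eq_or_eq_inv_smul_of_apply_eq {𝔓 𝔔 : HeightOneSpectrum (𝓞 L)} {n : ℕ} (hn : n ≠ 0)
    {x y : 𝓞 L} (hx : 𝔓.asIdeal ^ n = Ideal.span {x})
    (hy : ∀ w : HeightOneSpectrum (𝓞 L), y ∈ w.asIdeal → w = 𝔔)
    {w : InfinitePlace L} {c : L ≃ₐ[ℚ] L} (hc : ComplexEmbedding.IsConj w.embedding c)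
    (h : w (y : L) = w (x : L)) : 𝔔 = 𝔓 ∨ 𝔔 = c⁻¹ • 𝔓 := by
  have hO : y * c • y = x * c • x := by
    apply RingOfIntegers.coe_injective
    rw [map_mul, map_mul]
    exact mul_isConj_eq_of_apply_eq hc h
  have hle : Ideal.span {y} * Ideal.span {c • y} ≤ 𝔓.asIdeal := by
    rw [Ideal.span_singleton_mul_span_singleton, hO, ← Ideal.span_singleton_mul_span_singleton, ← hx,
      ← smul_pow_asIdeal_eq_span c hx]
    exact le_trans Ideal.mul_le_right (Ideal.pow_le_self hn)
  rcases (Ideal.IsPrime.mul_le 𝔓.isPrime).mp hle with h1 | h1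
  · rw [Ideal.span_singleton_le_iff_mem] at h1
    exact Or.inl (hy 𝔓 h1).symm
  · rw [Ideal.span_singleton_le_iff_mem] at h1
    refine Or.inr (hy _ ?_).symm
    rw [HeightOneSpectrum.smul_asIdeal, Ideal.mem_inv_pointwise_smul_iff]
    exact h1

/-- **Archimedean rigidity at a prime with trivial decomposition group.** For `L/ℚ` Galois, `𝔔` a prime
of `𝓞 L` with trivial decomposition group, `𝔔ⁿ = (x)` (`n ≠ 0`) and `y` supported on `𝔔`: `|y|_w = |x|_{w'}`
forces `w' = w` (write `w' = t • w`; `c`-orbit rigidity at `w` for `y`, `t⁻¹ x` gives `t ∈ {1, c⁻¹}`). Step of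
OUR proof of the [FrdI] Thm. 6.4 (iv) clause; not a statement of the source. [cite: MochizukiFrdI2008, Thm. 6.4 (iv) p.115] -/
theorem infinitePlace_eq_of_apply_eq [IsGalois ℚ L] {𝔔 : HeightOneSpectrum (𝓞 L)}
    (h𝔔 : MulAction.stabilizer (L ≃ₐ[ℚ] L) 𝔔 = ⊥) {n : ℕ} (hn : n ≠ 0) {x y : 𝓞 L}
    (hx : 𝔔.asIdeal ^ n = Ideal.span {x})
    (hy : ∀ w : HeightOneSpectrum (𝓞 L), y ∈ w.asIdeal → w = 𝔔)
    {w w' : InfinitePlace L} (h : w (y : L) = w' (x : L)) : w' = w := by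
  obtain ⟨t, rfl⟩ := exists_smul_infinitePlace_eq w w'
  obtain ⟨c, hc⟩ := exists_isConj_embedding w
  have hx' : (t⁻¹ • 𝔔).asIdeal ^ n = Ideal.span {t⁻¹ • x} := smul_pow_asIdeal_eq_span t⁻¹ hx
  have h' : w (y : L) = w ((t⁻¹ • x : 𝓞 L) : L) := by
    rw [h, InfinitePlace.smul_apply, RingOfIntegers.coe_algEquiv_smul, AlgEquiv.aut_inv]
  rcases eq_or_eq_inv_smul_of_apply_eq hn hx' hy hc h' with h1 | h1
  · have ht : t⁻¹ ∈ MulAction.stabilizer (L ≃ₐ[ℚ] L) 𝔔 := h1.symm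
    rw [h𝔔, Subgroup.mem_bot, inv_eq_one] at ht
    rw [ht, one_smul]
  · have ht : c⁻¹ * t⁻¹ ∈ MulAction.stabilizer (L ≃ₐ[ℚ] L) 𝔔 := by
      rw [MulAction.mem_stabilizer_iff, mul_smul]; exact h1.symm
    rw [h𝔔, Subgroup.mem_bot, ← mul_inv_rev, inv_eq_one] at ht
    rw [eq_inv_of_mul_eq_one_left ht, inv_smul_eq_iff, smul_eq_of_isConj_embedding hc]

end Helpers

/-! ### The main theorem -/

section Main

variable {L : Type} [Field L] [NumberField L] [IsGalois ℚ L]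

/-- **Rigidity of equivariant place transports** (main theorem; OUR steps (R3)–(R6) for the [FrdI]
Thm. 6.4 (iv) compatibility clause — nothing of [FrdI] asserted). For `L/ℚ` Galois, `H ≤ Gal(L/ℚ)`, any
map `θ`, a residue-characteristic-preserving permutation `π_f` of the finite places and a self-map `π_∞` of
the infinite places transporting principal divisors (`hprin`) equivariantly along `θ` over `H` (`hf`, `hi`),
there is ONE `s ∈ Gal(L/ℚ)` with `π_∞ = s • (·)` and `θ(H) ⊆ s H s⁻¹` (see the module docstring for the proof).
[cite: MochizukiFrdI2008, Thm. 6.4 (iv) p.115] -/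
theorem exists_forall_smul_eq_and_mem_conj_of_placeTransport
    (H : Subgroup (L ≃ₐ[ℚ] L)) (θ : (L ≃ₐ[ℚ] L) → (L ≃ₐ[ℚ] L))
    (πf : HeightOneSpectrum (𝓞 L) ≃ HeightOneSpectrum (𝓞 L)) (πi : InfinitePlace L → InfinitePlace L)
    (hover : ∀ w : HeightOneSpectrum (𝓞 L), (πf w).asIdeal.under ℤ = w.asIdeal.under ℤ)
    (hprin : ∀ x : L, x ≠ 0 → ∃ y : L,
      (∀ w : HeightOneSpectrum (𝓞 L), (πf w).valuation L y = w.valuation L x) ∧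
        ∀ v : InfinitePlace L, (πi v) y = v x)
    (hf : ∀ h ∈ H, ∀ w : HeightOneSpectrum (𝓞 L), πf (h • w) = θ h • πf w)
    (hi : ∀ h ∈ H, ∀ v : InfinitePlace L, πi (h • v) = θ h • πi v) :
    ∃ s : L ≃ₐ[ℚ] L, (∀ v : InfinitePlace L, πi v = s • v) ∧
      ∀ h ∈ H, ∃ h' ∈ H, θ h = s * h' * s⁻¹ := by
  classical
  -- transported generators are integral and supported exactly above `πf 𝔓`
  have key : ∀ (𝔓 : HeightOneSpectrum (𝓞 L)) (n : ℕ) (x : 𝓞 L), n ≠ 0 →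
      𝔓.asIdeal ^ n = Ideal.span {x} →
      ∃ y : 𝓞 L, (∀ w : HeightOneSpectrum (𝓞 L), y ∈ w.asIdeal → w = πf 𝔓) ∧
        ∀ v : InfinitePlace L, (πi v) (y : L) = v (x : L) := by
    intro 𝔓 n x hn hx
    have hx0 : x ≠ 0 := by
      rintro rfl
      exact pow_ne_zero n 𝔓.ne_bot (hx.trans (by simp))
    have hx0' : (x : L) ≠ 0 := fun h0 => hx0 (RingOfIntegers.coe_injective (by simpa using h0))
    obtain ⟨y, hyv, hyi⟩ := hprin (x : L) hx0'
    have hyint : ∀ w : HeightOneSpectrum (𝓞 L), w.valuation L y ≤ 1 := fun w => by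
      rw [← πf.apply_symm_apply w, hyv]
      exact HeightOneSpectrum.valuation_le_one _ _
    obtain ⟨y₀, rfl⟩ := HeightOneSpectrum.mem_integers_of_valuation_le_one L y hyint
    refine ⟨y₀, fun w hw => ?_, hyi⟩
    have h1 : (πf.symm w).valuation L (x : L) < 1 := by
      rw [← hyv, πf.apply_symm_apply]
      exact (HeightOneSpectrum.valuation_lt_one_iff_mem _ _).mpr hw
    have h2 : x ∈ (πf.symm w).asIdeal := (HeightOneSpectrum.valuation_lt_one_iff_mem _ _).mp h1
    rw [← (mem_asIdeal_iff_eq_of_pow_eq_span hn hx _).mp h2, πf.apply_symm_apply]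
  -- a prime with trivial decomposition group, a principal power of it, and its transport
  obtain ⟨-, 𝔓₀, -, -, -, h𝔓₀⟩ := exists_place_stabilizer_eq_bot (F := ℚ) (L := L)
  obtain ⟨n, x, hn, hx⟩ := exists_pow_asIdeal_eq_span 𝔓₀
  obtain ⟨y, hy, hyi⟩ := key 𝔓₀ n x hn hx
  -- `πf 𝔓₀ = s₀ • 𝔓₀` by transitivity of `Gal(L/ℚ)` on the primes above `𝔓₀ ∩ ℤ`
  obtain ⟨s₀, hs₀⟩ : ∃ s : L ≃ₐ[ℚ] L, s • 𝔓₀ = πf 𝔓₀ := by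
    haveI : IsGaloisGroup (L ≃ₐ[ℚ] L) ℤ (𝓞 L) := IsGaloisGroup.of_isFractionRing _ _ _ ℚ L
    haveI : 𝔓₀.asIdeal.LiesOver (𝔓₀.asIdeal.under ℤ) := ⟨rfl⟩
    haveI : (πf 𝔓₀).asIdeal.LiesOver (𝔓₀.asIdeal.under ℤ) := ⟨(hover 𝔓₀).symm⟩
    haveI : (πf 𝔓₀).asIdeal.IsPrime := (πf 𝔓₀).isPrime
    haveI : 𝔓₀.asIdeal.IsPrime := 𝔓₀.isPrime
    obtain ⟨s, hs⟩ := Ideal.exists_smul_eq_of_isGaloisGroup (𝔓₀.asIdeal.under ℤ) 𝔓₀.asIdeal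
      (πf 𝔓₀).asIdeal (L ≃ₐ[ℚ] L)
    exact ⟨s, HeightOneSpectrum.ext hs⟩
  have hstab : MulAction.stabilizer (L ≃ₐ[ℚ] L) (πf 𝔓₀) = ⊥ := by
    rw [← hs₀, MulAction.stabilizer_smul_eq_stabilizer_map_conj, h𝔓₀, Subgroup.map_bot]
  have hsx : (πf 𝔓₀).asIdeal ^ n = Ideal.span {s₀ • x} := by
    rw [← hs₀]; exact smul_pow_asIdeal_eq_span s₀ hx
  -- Step: `πi v = s₀ • v` for every infinite place
  have h4 : ∀ v : InfinitePlace L, πi v = s₀ • v := fun v => by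
    have h' : (πi v) (y : L) = (s₀ • v) ((s₀ • x : 𝓞 L) : L) := by
      rw [hyi v, InfinitePlace.smul_apply,
        RingOfIntegers.coe_algEquiv_smul, AlgEquiv.symm_apply_apply]
    exact (infinitePlace_eq_of_apply_eq hstab hn hsx hy h').symm
  refine ⟨s₀, h4, ?_⟩
  -- the defect `k h := s₀⁻¹ (θ h)⁻¹ s₀ h` fixes every infinite place
  have hk : ∀ h ∈ H, ∀ v : InfinitePlace L, (s₀⁻¹ * (θ h)⁻¹ * s₀ * h) • v = v := by
    intro h hh v
    have e := hi h hh v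
    rw [h4, h4] at e
    rw [mul_smul, mul_smul, mul_smul, e, inv_smul_smul, inv_smul_smul]
  by_cases hZ : ∀ g : L ≃ₐ[ℚ] L, (∀ v : InfinitePlace L, g • v = v) → g = 1
  · -- generic case: the pointwise stabiliser of the infinite places is trivial
    intro h hh
    refine ⟨h, hh, ?_⟩
    have e := hZ _ (hk h hh)
    rw [mul_assoc, mul_assoc, inv_mul_eq_one, eq_inv_mul_iff_mul_eq] at e
    rw [← e, mul_inv_cancel_right]
  · -- CM case: some `c ≠ 1` fixes every infinite place
    push Not at hZ
    obtain ⟨c, hcv, hc1⟩ := hZ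
    have hconj : ∀ v : InfinitePlace L, ComplexEmbedding.IsConj v.embedding c := fun v => by
      have hm : c ∈ MulAction.stabilizer (L ≃ₐ[ℚ] L) (InfinitePlace.mk v.embedding) := by
        rw [InfinitePlace.mk_embedding, MulAction.mem_stabilizer_iff]; exact hcv v
      exact ((InfinitePlace.mem_stabilizer_mk_iff (k := ℚ) v.embedding c).mp hm).resolve_left hc1
    obtain ⟨v₀⟩ : Nonempty (InfinitePlace L) := inferInstance
    have hZ' : ∀ g : L ≃ₐ[ℚ] L, (∀ v : InfinitePlace L, g • v = v) → g = 1 ∨ g = c := fun g hg => by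
      have hm : g ∈ MulAction.stabilizer (L ≃ₐ[ℚ] L) (InfinitePlace.mk v₀.embedding) := by
        rw [InfinitePlace.mk_embedding, MulAction.mem_stabilizer_iff]; exact hg v₀
      exact ((InfinitePlace.mem_stabilizer_mk_iff (k := ℚ) v₀.embedding g).mp hm).imp_right
        fun hg' => hg'.ext (hconj v₀)
    have hcinv : c⁻¹ = c := by
      rw [AlgEquiv.aut_inv]
      exact ((hconj v₀).symm).ext (hconj v₀)
    -- `c` is central
    have hcomm : ∀ g : L ≃ₐ[ℚ] L, Commute c g := fun g => by
      have hfix : ∀ v : InfinitePlace L, (g * c * g⁻¹) • v = v := fun v => by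
        rw [mul_smul, mul_smul, hcv, smul_inv_smul]
      rcases hZ' _ hfix with h1 | h1
      · exfalso
        apply hc1
        rwa [mul_inv_eq_one, mul_eq_left] at h1
      · rw [mul_inv_eq_iff_eq_mul] at h1
        exact h1.symm
    -- `c`-orbit property of `s₀⁻¹ ∘ πf` at every prime
    have horbit : ∀ 𝔓 : HeightOneSpectrum (𝓞 L), s₀⁻¹ • πf 𝔓 = 𝔓 ∨ s₀⁻¹ • πf 𝔓 = c • 𝔓 := fun 𝔓 => by
      obtain ⟨m, x₁, hm, hx₁⟩ := exists_pow_asIdeal_eq_span 𝔓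
      obtain ⟨y₁, hy₁, hy₁i⟩ := key 𝔓 m x₁ hm hx₁
      have h' : v₀ ((s₀⁻¹ • y₁ : 𝓞 L) : L) = v₀ (x₁ : L) := by
        rw [← hy₁i v₀, h4 v₀, InfinitePlace.smul_apply,
          RingOfIntegers.coe_algEquiv_smul, AlgEquiv.aut_inv]
      have hy' : ∀ w : HeightOneSpectrum (𝓞 L), s₀⁻¹ • y₁ ∈ w.asIdeal → w = s₀⁻¹ • πf 𝔓 := by
        intro w hw
        have hmem : y₁ ∈ (s₀ • w).asIdeal := by
          rw [HeightOneSpectrum.smul_asIdeal, Ideal.mem_pointwise_smul_iff_inv_smul_mem]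
          exact hw
        rw [← hy₁ _ hmem, inv_smul_smul]
      rcases eq_or_eq_inv_smul_of_apply_eq hm hx₁ hy' (hconj v₀) h' with h1 | h1
      · exact Or.inl h1
      · exact Or.inr (by rw [h1, hcinv])
    intro h hh
    rcases hZ' _ (hk h hh) with h1 | h1
    · refine ⟨h, hh, ?_⟩
      rw [mul_assoc, mul_assoc, inv_mul_eq_one, eq_inv_mul_iff_mul_eq] at h1
      rw [← h1, mul_inv_cancel_right]
    · -- `k h = c`: `θ h = s₀ (h c) s₀⁻¹`, and `c ∈ H` by twist rigidity at a prime with `D = ⟨h⟩`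
      have hθ : θ h = s₀ * (h * c) * s₀⁻¹ := by
        rw [mul_assoc, mul_assoc, inv_mul_eq_iff_eq_mul, inv_mul_eq_iff_eq_mul] at h1
        have : θ h = s₀ * h * (s₀ * c)⁻¹ := by rw [h1, mul_inv_cancel_right]
        rw [this, mul_inv_rev, hcinv]
        simp only [mul_assoc]
      have hπ' : ∀ W : HeightOneSpectrum (𝓞 L),
          (fun W => s₀⁻¹ • πf W) (h • W) = (h * c) • (fun W => s₀⁻¹ • πf W) W := fun W => by
        simp only
        rw [hf h hh W, hθ, smul_smul, smul_smul]
        congr 1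
        simp only [mul_assoc, inv_mul_cancel_left]
      have hcH : c ∈ H :=
        (Subgroup.zpowers_le.mpr hh)
          (mem_zpowers_of_twisted_equivariant_place (F := ℚ) (hcomm h) (fun W => s₀⁻¹ • πf W) horbit hπ')
      exact ⟨h * c, H.mul_mem hh hcH, hθ⟩

/-- **Subgroup form.** In the situation of `exists_forall_smul_eq_and_mem_conj_of_placeTransport`, if `θ`
maps `H` onto a subgroup `H₂` of the same order (e.g. `θ|_H` an isomorphism of groups `H ⥲ H₂`), then
`H₂ = s H s⁻¹` for the element `s` realising `π_∞` — `H` and `H₂` are CONJUGATE in `Gal(L/ℚ)`.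
(OUR step (R5)/(R6) of the [FrdI] Thm. 6.4 (iv) general-case argument; nothing of [FrdI] asserted.)
[cite: MochizukiFrdI2008, Thm. 6.4 (iv) p.115] -/
theorem exists_eq_map_conj_of_placeTransport
    (H H₂ : Subgroup (L ≃ₐ[ℚ] L)) (θ : (L ≃ₐ[ℚ] L) → (L ≃ₐ[ℚ] L))
    (πf : HeightOneSpectrum (𝓞 L) ≃ HeightOneSpectrum (𝓞 L)) (πi : InfinitePlace L → InfinitePlace L)
    (hover : ∀ w : HeightOneSpectrum (𝓞 L), (πf w).asIdeal.under ℤ = w.asIdeal.under ℤ)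
    (hprin : ∀ x : L, x ≠ 0 → ∃ y : L,
      (∀ w : HeightOneSpectrum (𝓞 L), (πf w).valuation L y = w.valuation L x) ∧
        ∀ v : InfinitePlace L, (πi v) y = v x)
    (hf : ∀ h ∈ H, ∀ w : HeightOneSpectrum (𝓞 L), πf (h • w) = θ h • πf w)
    (hi : ∀ h ∈ H, ∀ v : InfinitePlace L, πi (h • v) = θ h • πi v)
    (hH₂ : ∀ g ∈ H₂, ∃ h ∈ H, θ h = g) (hcard : Nat.card H₂ = Nat.card H) :
    ∃ s : L ≃ₐ[ℚ] L, (∀ v : InfinitePlace L, πi v = s • v) ∧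
      H₂ = H.map (MulAut.conj s).toMonoidHom := by
  obtain ⟨s, hs, hθ⟩ :=
    exists_forall_smul_eq_and_mem_conj_of_placeTransport H θ πf πi hover hprin hf hi
  refine ⟨s, hs, Subgroup.eq_of_le_of_card_ge ?_ ?_⟩
  · intro g hg
    obtain ⟨h, hh, rfl⟩ := hH₂ g hg
    obtain ⟨h', hh', he⟩ := hθ h hh
    rw [he]
    exact Subgroup.mem_map.mpr ⟨h', hh', rfl⟩
  · rw [Subgroup.card_map_of_injective (MulAut.conj s).injective, hcard]

/-- **Field form.** For `ℚ`-embeddings `i₁ : K₁ → L`, `i₂ : K₂ → L` of fields of the same degree into the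
Galois number field `L` (in the [FrdI] Thm. 6.4 (iv) situation: the base fields `F₁`, `F₂` read inside the
common Galois field `L₁ ≅ L₂`), an equivariant place transport along `θ` carrying `Gal(L/i₁K₁)` onto
`Gal(L/i₂K₂)` forces `K₁ ≅ K₂` over `ℚ` — the two fixing subgroups are conjugate by the `s` realising `π_∞`,
and `L^{sHs⁻¹} = s(L^H)`.  (OUR closing step for GAP-LEDGER G-L1t3-1 #2 of the abc-iut cell; nothing of
[FrdI] asserted.) [cite: MochizukiFrdI2008, Thm. 6.4 (iv) p.115] -/
theorem nonempty_algEquiv_of_placeTransport {K₁ K₂ : Type} [Field K₁] [Field K₂] [Algebra ℚ K₁]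
    [Algebra ℚ K₂] (i₁ : K₁ →ₐ[ℚ] L) (i₂ : K₂ →ₐ[ℚ] L) (θ : (L ≃ₐ[ℚ] L) → (L ≃ₐ[ℚ] L))
    (πf : HeightOneSpectrum (𝓞 L) ≃ HeightOneSpectrum (𝓞 L)) (πi : InfinitePlace L → InfinitePlace L)
    (hover : ∀ w : HeightOneSpectrum (𝓞 L), (πf w).asIdeal.under ℤ = w.asIdeal.under ℤ)
    (hprin : ∀ x : L, x ≠ 0 → ∃ y : L,
      (∀ w : HeightOneSpectrum (𝓞 L), (πf w).valuation L y = w.valuation L x) ∧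
        ∀ v : InfinitePlace L, (πi v) y = v x)
    (hf : ∀ h ∈ i₁.fieldRange.fixingSubgroup, ∀ w : HeightOneSpectrum (𝓞 L), πf (h • w) = θ h • πf w)
    (hi : ∀ h ∈ i₁.fieldRange.fixingSubgroup, ∀ v : InfinitePlace L, πi (h • v) = θ h • πi v)
    (hH₂ : ∀ g ∈ i₂.fieldRange.fixingSubgroup, ∃ h ∈ i₁.fieldRange.fixingSubgroup, θ h = g)
    (hdeg : Module.finrank ℚ K₁ = Module.finrank ℚ K₂) :
    Nonempty (K₁ ≃ₐ[ℚ] K₂) := by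
  set E₁ : IntermediateField ℚ L := i₁.fieldRange with hE₁
  set E₂ : IntermediateField ℚ L := i₂.fieldRange with hE₂
  have hcard : Nat.card E₂.fixingSubgroup = Nat.card E₁.fixingSubgroup := by
    rw [IsGalois.card_fixingSubgroup_eq_finrank E₁, IsGalois.card_fixingSubgroup_eq_finrank E₂]
    have h1 := Module.finrank_mul_finrank ℚ E₁ L
    have h2 := Module.finrank_mul_finrank ℚ E₂ L
    rw [← i₁.equivFieldRange.toLinearEquiv.finrank_eq] at h1
    rw [← i₂.equivFieldRange.toLinearEquiv.finrank_eq, ← hdeg, ← h1] at h2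
    have hpos : 0 < Module.finrank ℚ K₁ := by
      rw [i₁.equivFieldRange.toLinearEquiv.finrank_eq]
      exact Module.finrank_pos
    exact Nat.eq_of_mul_eq_mul_left hpos h2
  obtain ⟨s, -, hconj⟩ := exists_eq_map_conj_of_placeTransport E₁.fixingSubgroup E₂.fixingSubgroup θ πf πi
    hover hprin hf hi hH₂ hcard
  have hfix : E₂ = E₁.map (s : L →ₐ[ℚ] L) := by
    rw [← IsGalois.fixedField_fixingSubgroup E₂, hconj, fixedField_map_conj,
      IsGalois.fixedField_fixingSubgroup]
  exact ⟨(i₁.equivFieldRange.trans ((IntermediateField.equivMap E₁ (s : L →ₐ[ℚ] L)).trans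
    (IntermediateField.equivOfEq hfix.symm))).trans i₂.equivFieldRange.symm⟩

end Main

end Literature.NumberTheory.NumberFields

end
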